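import Mathlib
import Summits.Ventures.HodgeRepro.Tier4.Target
import Summits.Ventures.HodgeRepro.Tier4.Common.TargetBall
import Summits.Ventures.HodgeRepro.Tier4.Common.AutForms
import Summits.Ventures.HodgeRepro.Tier4.Line3.KMDatum
import Summits.Ventures.HodgeRepro.Tier4.Line3.KMDatumS
import Summits.Ventures.HodgeRepro.Tier4.Line3.Defs
import Summits.Ventures.HodgeRepro.Tier4.Line3.HeckeEquivarianceLemmas
import Summits.Ventures.HodgeRepro.Tier4.Line3.KernelIntegralPosS
import Summits.Ventures.HodgeRepro.Tier4.Line3.FibreCount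
import Summits.Ventures.HodgeRepro.Tier4.Line3.KernelEquivariance
import Summits.Ventures.HodgeRepro.Tier4.Line3.CoefInvariance
import Summits.Ventures.HodgeRepro.Tier4.Line3.TorusInvariance
import Summits.Ventures.HodgeRepro.Tier4.Line3.ClassRegrouping
import Summits.Ventures.HodgeRepro.Tier4.Line3.MainClassReps
import Summits.Ventures.HodgeRepro.Tier4.Line3.ClassFibres
import Summits.Ventures.HodgeRepro.Tier4.Line3.CentreFibres
import Summits.Ventures.HodgeRepro.Tier4.Line3.CentreFinite
import Summits.Ventures.HodgeRepro.Tier4.Line3.StabFiniteApi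
import Summits.Ventures.HodgeRepro.Tier4.Line3.MainTermAssembly

/-!
# Tier4/Line3/MainTermInterchange — the interchange `∫_D Σ′ = Σ′ ∫_D` for the class-kernel family (L3.6a, R-d)

Blind re-derivation cell `pub-hodge-repro`, Tier 4 «PROVE THE STEP» (README §9–§10), LINE L3, seat t4-L3-p1 (prover);
the residual R-d of proofs/t4/L3/L36a-support.md.  The two interchanges `hI1`, `hI2` of `MainTermAssembly` are replaced by
ONE interchange over the sigma type `Σ c : MainClass, Γ′` for the family
`G (c, g) z := stabCard(x_c)⁻¹ · coefQ (x_c) · kernel (g • x_c, z)` (`classKernel`), which needs no measurability of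
inner sums: each `G p` is continuous on the ball (`continuousOn_classKernel`), and the enorm series is controlled by the
majorant `h2` of L3.2a — `Σ′_p ‖G p z‖ₑ = Σ′_{w ∈ [xm]} ‖summand w z‖ₑ ≤ Σ′_w ‖summand w z‖ₑ` (`tsum_enorm_classKernel`,
the fibre count in `ℝ≥0∞`), whose integral over `D` is finite (`lintegral_tsum_classKernel_ne_top`).  Mathlib's
`integral_tsum` then gives `∫_D Σ′_p G p = Σ′_p ∫_D G p` (`integral_tsum_classKernel`).

**`term_main_unfold_full`** assembles L3.6a with only `hab` (independence of `xm 0, xm 1`), `hD`, the (F)-repaired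
majorant `h2`, and `hint` (integrability of `kernel (mainRep c, ·)` on the ball) as hypotheses.

Nothing here asserts anything about the truth of (P); HC_CM is NOT proved by anyone in this repository.
-/

set_option autoImplicit false

noncomputable section

namespace Summit.Ventures.HodgeRepro.Tier4.Line3

open Summit.Ventures.HodgeRepro.Tier4
open Matrix MeasureTheory
open scoped ENNReal
open HeckeEquivariance

namespace T4Data

variable (X : T4Data)

/-- The kernel is continuous on the ball. -/
theorem continuousOn_kernel (Φ : KMDatumS) (x : X.Tuple) : ContinuousOn (fun z => X.kernel Φ x z) ball := by
  unfold T4Data.kernel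
  exact (continuousOn_wedge_datumS Φ _ _).mul
    (Complex.continuous_conj.comp_continuousOn (continuousOn_wedge_datumS Φ _ _))

/-- The class-kernel family: `G (c, g) z = stabCard(x_c)⁻¹ · coefQ (x_c) · kernel (g • x_c, z)`. -/
def classKernel (D : X.ThetaData) {K : X.Level} (γ : X.Tr K) (xm : X.Tuple)
    (p : Σ _ : X.MainClass K xm, {g : Matrix (Fin 3) (Fin 3) X.E // g ∈ K.1}) (z : Fin 2 → ℂ) : ℂ :=
  ((X.stabCard K (X.mainRep K xm p.1) : ℂ))⁻¹ * X.coefQ D.cf γ (X.mainRep K xm p.1) *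
    X.kernel D.Φ (fun j => p.2.1 *ᵥ X.mainRep K xm p.1 j) z

/-- Each member of the family is continuous on the ball. -/
theorem continuousOn_classKernel (D : X.ThetaData) {K : X.Level} (γ : X.Tr K) (xm : X.Tuple)
    (p : Σ _ : X.MainClass K xm, {g : Matrix (Fin 3) (Fin 3) X.E // g ∈ K.1}) :
    ContinuousOn (X.classKernel D γ xm p) ball :=
  continuousOn_const.mul (X.continuousOn_kernel D.Φ _)

/-- The enorm of `G (c, g) z` is `stabCard⁻¹ · ‖summand (classMap g) z‖ₑ`. -/
theorem enorm_classKernel (D : X.ThetaData) {K : X.Level} (γ : X.Tr K) (xm : X.Tuple)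
    (c : X.MainClass K xm) [Finite (X.Stab K (X.mainRep K xm c))]
    (g : {g : Matrix (Fin 3) (Fin 3) X.E // g ∈ K.1}) (z : Fin 2 → ℂ) :
    ‖X.classKernel D γ xm ⟨c, g⟩ z‖ₑ =
      ((X.stabCard K (X.mainRep K xm c) : ℝ≥0∞))⁻¹ * ‖X.summand D.Φ D.cf γ (X.classMap K xm c g).1 z‖ₑ := by
  unfold T4Data.classKernel
  rw [X.summand_classMap D γ xm c g z, mul_assoc, enorm_mul, enorm_mul]
  congr 1
  have hne : (X.stabCard K (X.mainRep K xm c) : ℂ) ≠ 0 := by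
    exact_mod_cast X.stabCard_ne_zero K (X.mainRep K xm c)
  rw [enorm_inv hne, ← ofReal_norm, Complex.norm_natCast, ENNReal.ofReal_natCast]

/-- **THE ENORM SERIES OF THE FAMILY** at `z` is the enorm series of the summand over the main orbit. -/
theorem tsum_enorm_classKernel (D : X.ThetaData) {K : X.Level} (γ : X.Tr K) (xm : X.Tuple)
    (hfin : ∀ c : X.MainClass K xm, Finite (X.Stab K (X.mainRep K xm c))) (z : Fin 2 → ℂ) :
    ∑' p : Σ _ : X.MainClass K xm, {g : Matrix (Fin 3) (Fin 3) X.E // g ∈ K.1}, ‖X.classKernel D γ xm p z‖ₑ =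
      ∑' w : {w : X.LineTuple // X.orbitOf w = X.orbitOf (X.lines xm)}, ‖X.summand D.Φ D.cf γ w.1 z‖ₑ := by
  rw [ENNReal.tsum_sigma']
  -- regroup the right-hand side by classes
  rw [← (X.orbitClassEquiv K xm).symm.tsum_eq, ENNReal.tsum_sigma']
  refine tsum_congr fun c => ?_
  haveI := hfin c
  haveI : ∀ w : {w : X.LineTuple // X.classOf K w = c.1},
      Finite {g : {g : Matrix (Fin 3) (Fin 3) X.E // g ∈ K.1} // X.classMap K xm c g = w} :=
    fun w => X.finite_classMap_fibre K xm c w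
  haveI : ∀ w : {w : X.LineTuple // X.classOf K w = c.1},
      Fintype {g : {g : Matrix (Fin 3) (Fin 3) X.E // g ∈ K.1} // X.classMap K xm c g = w} :=
    fun w => Fintype.ofFinite _
  -- the fibre count in `ℝ≥0∞`
  have h1 : ∑' g : {g : Matrix (Fin 3) (Fin 3) X.E // g ∈ K.1}, ‖X.classKernel D γ xm ⟨c, g⟩ z‖ₑ =
      ((X.stabCard K (X.mainRep K xm c) : ℝ≥0∞))⁻¹ *
        ∑' g : {g : Matrix (Fin 3) (Fin 3) X.E // g ∈ K.1},
          ‖X.summand D.Φ D.cf γ (X.classMap K xm c g).1 z‖ₑ := by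
    simp_rw [X.enorm_classKernel D γ xm c]
    rw [ENNReal.tsum_mul_left]
  have h2 : ∑' g : {g : Matrix (Fin 3) (Fin 3) X.E // g ∈ K.1},
      ‖X.summand D.Φ D.cf γ (X.classMap K xm c g).1 z‖ₑ =
      (X.stabCard K (X.mainRep K xm c) : ℝ≥0∞) *
        ∑' w : {w : X.LineTuple // X.classOf K w = c.1}, ‖X.summand D.Φ D.cf γ w.1 z‖ₑ := by
    rw [tsum_enorm_comp_eq (X.classMap K xm c) (fun w => X.summand D.Φ D.cf γ w.1 z)]
    simp_rw [tsum_fibre_const (X.classMap K xm c)]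
    have hcard : ∀ w : {w : X.LineTuple // X.classOf K w = c.1},
        (Fintype.card {g : {g : Matrix (Fin 3) (Fin 3) X.E // g ∈ K.1} // X.classMap K xm c g = w} : ℝ≥0∞) =
          (X.stabCard K (X.mainRep K xm c) : ℝ≥0∞) := by
      intro w
      rw [Fintype.card_eq_nat_card, X.natCard_classMap_fibre K xm c w]
    simp_rw [hcard]
    rw [ENNReal.tsum_mul_left]
  rw [h1, h2, ← mul_assoc]
  have hn : (X.stabCard K (X.mainRep K xm c) : ℝ≥0∞) ≠ 0 := by
    exact_mod_cast X.stabCard_ne_zero K (X.mainRep K xm c)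
  rw [ENNReal.inv_mul_cancel hn (ENNReal.natCast_ne_top _), one_mul]
  -- the class sum on the right, through the equivalence
  refine tsum_congr fun w => ?_
  rfl

/-- The enorm series of the family is bounded by the majorant series of L3.2a. -/
theorem tsum_enorm_classKernel_le (D : X.ThetaData) {K : X.Level} (γ : X.Tr K) (xm : X.Tuple)
    (hfin : ∀ c : X.MainClass K xm, Finite (X.Stab K (X.mainRep K xm c))) (z : Fin 2 → ℂ) :
    ∑' p : Σ _ : X.MainClass K xm, {g : Matrix (Fin 3) (Fin 3) X.E // g ∈ K.1}, ‖X.classKernel D γ xm p z‖ₑ ≤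
      ∑' w : X.LineTuple, ‖X.summand D.Φ D.cf γ w z‖ₑ := by
  rw [X.tsum_enorm_classKernel D γ xm hfin z]
  exact ENNReal.tsum_comp_le_tsum_of_injective Subtype.val_injective
    (fun w => ‖X.summand D.Φ D.cf γ w z‖ₑ)

/-- The family is summable at every `z` where the majorant is. -/
theorem summable_classKernel (D : X.ThetaData) {K : X.Level} (γ : X.Tr K) (xm : X.Tuple)
    (hfin : ∀ c : X.MainClass K xm, Finite (X.Stab K (X.mainRep K xm c))) (z : Fin 2 → ℂ)
    (hs : Summable fun w : X.LineTuple => ‖X.summand D.Φ D.cf γ w z‖) :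
    Summable fun p : Σ _ : X.MainClass K xm, {g : Matrix (Fin 3) (Fin 3) X.E // g ∈ K.1} =>
      ‖X.classKernel D γ xm p z‖ := by
  rw [← tsum_enorm_ne_top_iff_summable_norm]
  refine ne_top_of_le_ne_top ?_ (X.tsum_enorm_classKernel_le D γ xm hfin z)
  exact tsum_enorm_ne_top_iff_summable_norm.mpr hs

/-- `E′` is countable (a finite-dimensional `ℚ`-space). -/
theorem countable_E : Countable X.E := Finsupp.Countable.of_moduleFinite (R := ℚ)

/-- The lines are countable. -/
theorem countable_line : Countable X.Line := by
  haveI := X.countable_E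
  exact inferInstanceAs (Countable (Quot X.lineStep))

/-- The main classes are countable. -/
theorem countable_mainClass (K : X.Level) (xm : X.Tuple) : Countable (X.MainClass K xm) := by
  haveI := X.countable_line
  haveI : Countable (X.Class K) := inferInstanceAs (Countable (Quot (X.classStep K)))
  exact inferInstanceAs (Countable {c : X.Class K // X.orbitOf (Quot.out c) = X.orbitOf (X.lines xm)})

/-- `Γ′` is countable. -/
theorem countable_level (K : X.Level) : Countable {g : Matrix (Fin 3) (Fin 3) X.E // g ∈ K.1} := by
  haveI := X.countable_E
  haveI : Countable (Matrix (Fin 3) (Fin 3) X.E) := inferInstanceAs (Countable (Fin 3 → Fin 3 → X.E))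
  infer_instance

/-- The index type of the class-kernel family is countable. -/
theorem countable_classSigma (K : X.Level) (xm : X.Tuple) :
    Countable (Σ _ : X.MainClass K xm, {g : Matrix (Fin 3) (Fin 3) X.E // g ∈ K.1}) := by
  haveI := X.countable_mainClass K xm
  haveI := X.countable_level K
  infer_instance

/-- **THE LINTEGRAL OF THE ENORM SERIES IS FINITE** (from the majorant `h2`). -/
theorem lintegral_tsum_classKernel_ne_top (D : X.ThetaData) {K : X.Level} (γ : X.Tr K) (xm : X.Tuple)
    (hfin : ∀ c : X.MainClass K xm, Finite (X.Stab K (X.mainRep K xm c)))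
    (hD : IsFundamentalDomainFor (ballActions X.τ₀ X.C K.1) (X.domain K))
    (h2 : (∀ z ∈ X.domain K, Summable fun w : X.LineTuple => ‖X.summand D.Φ D.cf γ w z‖) ∧
      IntegrableOn (fun z => ∑' w : X.LineTuple, ‖X.summand D.Φ D.cf γ w z‖) (X.domain K)) :
    ∑' p : Σ _ : X.MainClass K xm, {g : Matrix (Fin 3) (Fin 3) X.E // g ∈ K.1},
      ∫⁻ z, ‖X.classKernel D γ xm p z‖ₑ ∂(volume.restrict (X.domain K)) ≠ ∞ := by
  haveI := X.countable_classSigma K xm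
  have hmeas : ∀ p : Σ _ : X.MainClass K xm, {g : Matrix (Fin 3) (Fin 3) X.E // g ∈ K.1},
      AEMeasurable (fun z => ‖X.classKernel D γ xm p z‖ₑ) (volume.restrict (X.domain K)) := fun p =>
    (((X.continuousOn_classKernel D γ xm p).mono hD.2.1).aestronglyMeasurable hD.1).enorm
  rw [← lintegral_tsum hmeas]
  -- bound by the majorant, pointwise on `D`
  have hmaj : ∫⁻ z, ∑' p : Σ _ : X.MainClass K xm, {g : Matrix (Fin 3) (Fin 3) X.E // g ∈ K.1},
      ‖X.classKernel D γ xm p z‖ₑ ∂(volume.restrict (X.domain K)) ≤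
      ∫⁻ z, ‖∑' w : X.LineTuple, ‖X.summand D.Φ D.cf γ w z‖‖ₑ ∂(volume.restrict (X.domain K)) := by
    refine lintegral_mono_ae ?_
    refine (ae_restrict_mem hD.1).mono fun z hz => ?_
    refine (X.tsum_enorm_classKernel_le D γ xm hfin z).trans (le_of_eq ?_)
    rw [Real.enorm_of_nonneg (tsum_nonneg fun w => norm_nonneg _),
      ENNReal.ofReal_tsum_of_nonneg (fun w => norm_nonneg _) (h2.1 z hz)]
    refine tsum_congr fun w => ?_
    rw [ofReal_norm]
  exact ne_top_of_le_ne_top h2.2.hasFiniteIntegral.ne hmaj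

/-- **THE INTERCHANGE** `∫_D Σ′_p G p = Σ′_p ∫_D G p`. -/
theorem integral_tsum_classKernel (D : X.ThetaData) {K : X.Level} (γ : X.Tr K) (xm : X.Tuple)
    (hfin : ∀ c : X.MainClass K xm, Finite (X.Stab K (X.mainRep K xm c)))
    (hD : IsFundamentalDomainFor (ballActions X.τ₀ X.C K.1) (X.domain K))
    (h2 : (∀ z ∈ X.domain K, Summable fun w : X.LineTuple => ‖X.summand D.Φ D.cf γ w z‖) ∧
      IntegrableOn (fun z => ∑' w : X.LineTuple, ‖X.summand D.Φ D.cf γ w z‖) (X.domain K)) :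
    ∫ z in X.domain K, ∑' p : Σ _ : X.MainClass K xm, {g : Matrix (Fin 3) (Fin 3) X.E // g ∈ K.1},
        X.classKernel D γ xm p z =
      ∑' p : Σ _ : X.MainClass K xm, {g : Matrix (Fin 3) (Fin 3) X.E // g ∈ K.1},
        ∫ z in X.domain K, X.classKernel D γ xm p z := by
  haveI := X.countable_classSigma K xm
  exact integral_tsum (fun p => ((X.continuousOn_classKernel D γ xm p).mono hD.2.1).aestronglyMeasurable hD.1)
    (X.lintegral_tsum_classKernel_ne_top D γ xm hfin hD h2)

/-! ## The assembly with the interchange discharged -/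

/-- Pointwise on `D`, the orbit sum is the sum of the class-kernel family. -/
theorem tsum_orbit_eq_tsum_classKernel (D : X.ThetaData) {K : X.Level} (γ : X.Tr K) (xm : X.Tuple)
    (hfin : ∀ c : X.MainClass K xm, Finite (X.Stab K (X.mainRep K xm c))) (z : Fin 2 → ℂ)
    (hs : Summable fun w : X.LineTuple => ‖X.summand D.Φ D.cf γ w z‖) :
    ∑' w : {w : X.LineTuple // X.orbitOf w = X.orbitOf (X.lines xm)}, X.summand D.Φ D.cf γ w.1 z =
      ∑' p : Σ _ : X.MainClass K xm, {g : Matrix (Fin 3) (Fin 3) X.E // g ∈ K.1}, X.classKernel D γ xm p z := by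
  rw [X.tsum_mainOrbit_eq_tsum_mainClass K xm _ (X.summable_mainOrbit_of_norm xm hs),
    (X.summable_classKernel D γ xm hfin z hs).of_norm.tsum_sigma]
  refine tsum_congr fun c => ?_
  haveI := hfin c
  rw [X.tsum_class_eq D γ xm c z hs]
  show _ = ∑' g : {g : Matrix (Fin 3) (Fin 3) X.E // g ∈ K.1},
    ((X.stabCard K (X.mainRep K xm c) : ℂ))⁻¹ * X.coefQ D.cf γ (X.mainRep K xm c) *
      X.kernel D.Φ (fun j => g.1 *ᵥ X.mainRep K xm c j) z
  rw [tsum_mul_left]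

/-- The integrals of the family over `D` are summable. -/
theorem summable_integral_classKernel (D : X.ThetaData) {K : X.Level} (γ : X.Tr K) (xm : X.Tuple)
    (hfin : ∀ c : X.MainClass K xm, Finite (X.Stab K (X.mainRep K xm c)))
    (hD : IsFundamentalDomainFor (ballActions X.τ₀ X.C K.1) (X.domain K))
    (h2 : (∀ z ∈ X.domain K, Summable fun w : X.LineTuple => ‖X.summand D.Φ D.cf γ w z‖) ∧
      IntegrableOn (fun z => ∑' w : X.LineTuple, ‖X.summand D.Φ D.cf γ w z‖) (X.domain K)) :
    Summable fun p : Σ _ : X.MainClass K xm, {g : Matrix (Fin 3) (Fin 3) X.E // g ∈ K.1} =>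
      ∫ z in X.domain K, X.classKernel D γ xm p z := by
  have hmeas : ∀ p : Σ _ : X.MainClass K xm, {g : Matrix (Fin 3) (Fin 3) X.E // g ∈ K.1},
      AEStronglyMeasurable (X.classKernel D γ xm p) (volume.restrict (X.domain K)) := fun p =>
    ((X.continuousOn_classKernel D γ xm p).mono hD.2.1).aestronglyMeasurable hD.1
  have hsum : Summable fun p : Σ _ : X.MainClass K xm, {g : Matrix (Fin 3) (Fin 3) X.E // g ∈ K.1} =>
      ∫ z in X.domain K, ‖X.classKernel D γ xm p z‖ := by
    have h := ENNReal.summable_toReal (X.lintegral_tsum_classKernel_ne_top D γ xm hfin hD h2)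
    refine h.congr fun p => ?_
    rw [integral_norm_eq_lintegral_enorm (hmeas p)]
  exact Summable.of_norm_bounded hsum fun p => norm_integral_le_integral_norm _

/-- **L3.6a ASSEMBLED WITH THE INTERCHANGE DISCHARGED** (`term_main_unfold`, modulo `hfin` and `hint`):
`term (Φ, cf, K, γ, [xm]) = (∫_𝔹 kernel xm) · classSum`. -/
theorem term_main_unfold_full (D : X.ThetaData) (xm : X.Tuple) {K : X.Level} (γ : X.Tr K)
    (hD : IsFundamentalDomainFor (ballActions X.τ₀ X.C K.1) (X.domain K))
    (hfin : ∀ c : X.MainClass K xm, Finite (X.Stab K (X.mainRep K xm c)))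
    (h2 : (∀ z ∈ X.domain K, Summable fun w : X.LineTuple => ‖X.summand D.Φ D.cf γ w z‖) ∧
      IntegrableOn (fun z => ∑' w : X.LineTuple, ‖X.summand D.Φ D.cf γ w z‖) (X.domain K))
    (hint : ∀ c : X.MainClass K xm, IntegrableOn (fun z => X.kernel D.Φ (X.mainRep K xm c) z) ball) :
    X.term D.Φ D.cf K γ (X.orbitOf (X.lines xm)) = (∫ z in ball, X.kernel D.Φ xm z) * X.classSum D.cf γ xm := by
  unfold T4Data.term T4Data.classSum
  have hcongr : ∫ z in X.domain K, ∑' w : {w : X.LineTuple // X.orbitOf w = X.orbitOf (X.lines xm)},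
        X.summand D.Φ D.cf γ w.1 z =
      ∫ z in X.domain K, ∑' p : Σ _ : X.MainClass K xm, {g : Matrix (Fin 3) (Fin 3) X.E // g ∈ K.1},
        X.classKernel D γ xm p z :=
    setIntegral_congr_fun hD.1 fun z hz => X.tsum_orbit_eq_tsum_classKernel D γ xm hfin z (h2.1 z hz)
  rw [hcongr, X.integral_tsum_classKernel D γ xm hfin hD h2,
    (X.summable_integral_classKernel D γ xm hfin hD h2).tsum_sigma]
  have hc : ∀ c : X.MainClass K xm,
      ∑' g : {g : Matrix (Fin 3) (Fin 3) X.E // g ∈ K.1}, ∫ z in X.domain K, X.classKernel D γ xm ⟨c, g⟩ z =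
        ((X.centerCard K : ℂ) / (X.stabCard K (X.mainRep K xm c) : ℂ)) * X.coefQ D.cf γ (X.mainRep K xm c) *
          ∫ z in ball, X.kernel D.Φ xm z := by
    intro c
    have hk : ∫ z in ball, X.kernel D.Φ (X.mainRep K xm c) z = ∫ z in ball, X.kernel D.Φ xm z :=
      X.integral_kernel_mulVec D (X.gRep_isUnitaryOf K xm c) xm
    show ∑' g : {g : Matrix (Fin 3) (Fin 3) X.E // g ∈ K.1}, ∫ z in X.domain K,
      ((X.stabCard K (X.mainRep K xm c) : ℂ))⁻¹ * X.coefQ D.cf γ (X.mainRep K xm c) *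
        X.kernel D.Φ (fun j => g.1 *ᵥ X.mainRep K xm c j) z = _
    simp_rw [integral_const_mul]
    rw [tsum_mul_left, X.tsum_integral_kernel_mulVec D K hD (X.mainRep K xm c) (hint c), hk]
    ring
  simp_rw [hc]
  rw [tsum_mul_right, mul_comm]

end T4Data

/-! ## Integrability of the kernel is `U(H)`-invariant -/

/-- **INTEGRABILITY UNDER THE BALL ACTION**: for `M ∈ U(2,1)`, `g` is integrable on the ball iff
`normSq (jacDetMap (actM M)) · g ∘ actM M` is. -/
theorem integrableOn_ball_actM {M : Matrix (Fin 3) (Fin 3) ℂ} (hM : Mᴴ * J * M = J) (g : (Fin 2 → ℂ) → ℂ) :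
    IntegrableOn g ball ↔
      IntegrableOn (fun z => (Complex.normSq (jacDetMap (actM M) z) : ℂ) * g (actM M z)) ball := by
  have hdiff : ∀ z ∈ ball, DifferentiableAt ℂ (actM M) z := fun z hz =>
    (differentiableOn_actM hM).differentiableAt (isOpen_ball.mem_nhds hz)
  have hf' : ∀ z ∈ ball, HasFDerivWithinAt (actM M) ((fderiv ℂ (actM M) z).restrictScalars ℝ) ball z :=
    fun z hz => ((hdiff z hz).hasFDerivAt.restrictScalars ℝ).hasFDerivWithinAt
  have h := integrableOn_image_iff_integrableOn_abs_det_fderiv_smul (μ := volume) isOpen_ball.measurableSet hf'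
    (actM_injOn_ball hM) g
  rw [actM_image_ball hM] at h
  rw [h]
  constructor
  · intro h1
    refine h1.congr_fun (fun z hz => ?_) isOpen_ball.measurableSet
    simp only
    rw [det_restrictScalars_fderiv (hdiff z hz), abs_of_nonneg (Complex.normSq_nonneg _), Complex.real_smul]
  · intro h1
    refine h1.congr_fun (fun z hz => ?_) isOpen_ball.measurableSet
    simp only
    rw [det_restrictScalars_fderiv (hdiff z hz), abs_of_nonneg (Complex.normSq_nonneg _), Complex.real_smul]

namespace T4Data

variable (X : T4Data)

/-- The kernel of `g • x` is integrable on the ball when the kernel of `x` is (`g ∈ U(H)`). -/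
theorem integrableOn_kernel_mulVec (D : X.ThetaData) {g : Matrix (Fin 3) (Fin 3) X.E} (hg : IsUnitaryOf X.c X.H g)
    (x : X.Tuple) (h : IntegrableOn (fun z => X.kernel D.Φ x z) ball) :
    IntegrableOn (fun z => X.kernel D.Φ (fun j => g *ᵥ x j) z) ball := by
  have hM : (toBallMat X.τ₀ X.C g)ᴴ * J * toBallMat X.τ₀ X.C g = J := toBallMat_J_of_unitary X hg
  rw [integrableOn_ball_actM hM]
  refine h.congr_fun (fun z hz => ?_) isOpen_ball.measurableSet
  exact X.kernel_equiv D hg x hz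

/-- **L3.6a, FINAL FORM** (only `hab`, `hD`, `h2` and the integrability of the kernel at `xm` are assumed):
`term (Φ, cf, K, γ, [xm]) = (∫_𝔹 kernel xm) · classSum`. -/
theorem term_main_unfold_full' (D : X.ThetaData) (xm : X.Tuple) (hab : LinearIndependent X.E ![xm 0, xm 1])
    {K : X.Level} (γ : X.Tr K)
    (hD : IsFundamentalDomainFor (ballActions X.τ₀ X.C K.1) (X.domain K))
    (h2 : (∀ z ∈ X.domain K, Summable fun w : X.LineTuple => ‖X.summand D.Φ D.cf γ w z‖) ∧
      IntegrableOn (fun z => ∑' w : X.LineTuple, ‖X.summand D.Φ D.cf γ w z‖) (X.domain K))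
    (hint : IntegrableOn (fun z => X.kernel D.Φ xm z) ball) :
    X.term D.Φ D.cf K γ (X.orbitOf (X.lines xm)) = (∫ z in ball, X.kernel D.Φ xm z) * X.classSum D.cf γ xm :=
  X.term_main_unfold_full D xm γ hD (fun c => X.finite_stab_mainRep K xm hab c) h2
    (fun c => X.integrableOn_kernel_mulVec D (X.gRep_isUnitaryOf K xm c) xm hint)

end T4Data

end Summit.Ventures.HodgeRepro.Tier4.Line3

end
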